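import Summits.ResolutionOfSingularities.ResolutionOfSingularities.Theorems.UniversalCellsCampaignW82FamilyResolutionInsep
import Summits.ResolutionOfSingularities.ResolutionOfSingularities.Theorems.UniformComplexityPrimeModelTransferFamilyResolutionSpreadEmbedding
import Literature.AlgebraicGeometry.Resolution.ResolutionOfCurves
import HarnessLib

/-!
# Crux `PrimeFieldToPerfect` (stmt-ResolutionOfSingularities-15233), door 1 of slot W8.2:
# RADICIAL FAMILY RESOLUTION holds for families of CURVES (unconditionally) and in fibre dimension `≤ 3`
# (modulo F-02) — rungs of the door-1 family form

Route `ResolutionOfSingularities/UniversalCells`. The door-1 family form `CampaignW82.FamilyResolutionInsep p k`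
(OURS module p533235; `↔` the crux slice given resolution over `𝔽_p`, links p535806) asks, for a proper
family `𝒳 → Spec A` with integral radicial generic fibre `𝒳 ×_A Spec L` (`L` a perfect closure of `Frac A`),
for a RADICIAL finite-type base extension `A → A'` and one morphism weakly resolving all field-valued fibres.
By the spreading theorem with embedding (`PrimeModelTransfer.exists_familyResolution_datum_embedding`,
p532724) this datum exists as soon as `𝒳 ×_A Spec L` has a resolution — a scheme over the perfect field `L`,
so resolution of curves (tree `Resolution.hasResolution_of_dim_le_one`) and, modulo the named fact F-02,
`CossartPiltant2019` in dimension `≤ 3`, apply. No graded OURS `Prop` is introduced; the rungs are stated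
with the dimension hypothesis explicit (the door-2 analogues are `CampaignW82.familyResolutionDimLe_one` /
`…_three_of_cossartPiltant`, p531789):

* `exists_familyResolutionInsep_datum_of_hasResolution` — the datum of `FamilyResolutionInsep` for ONE
  proper family, from a resolution of its radicial generic fibre (any Noetherian domain `A` of
  characteristic `p`, any perfect radicial `L`);
* `exists_familyResolutionInsep_datum_of_dim_le_one` — **unconditionally for radicial generic fibres of
  dimension `≤ 1`** (simultaneous resolution of the fibres of a proper family of curves, generically on the
  base, after a radicial base extension);
* `exists_familyResolutionInsep_datum_of_dim_le_three` — for dimension `≤ 3`, conditional on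
  `CossartPiltant2019` (hypothesis `h`).

[OURS · LADDER-RESOLUTION L1, slot W8.2 (prime-field / universality transfer), door 1 UniversalCells]
Theorems over the summit's own route and OURS names; NOT statements of, and attributing nothing to,
Hironaka's 2017 manuscript. AI-written; weaker than expert review. Theses-free. The `≤ 3` rung is
CONDITIONAL on the named fact F-02.

Sources: R. Hartshorne, *Algebraic Geometry* (1977) V Rem. 3.8.1; V. Cossart, O. Piltant, J. Algebra 529
(2019) Thm. 1.1 (named fact); EGA IV₃ (1966) Thm. 8.10.5. [cite: Hartshorne1977, Ch. V Rem. 3.8.1]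
[cite: CossartPiltant2019, Thm. 1.1] [cite: EGAIV3, Thm. 8.10.5]
-/

noncomputable section

set_option linter.dupNamespace false -- mandated namespace of this single-conjunct summit

open CategoryTheory CategoryTheory.Limits AlgebraicGeometry TopologicalSpace
open Literature.AlgebraicGeometry.Resolution

namespace Summit.ResolutionOfSingularities.ResolutionOfSingularities.Theorems.CampaignW82

/-- **The `FamilyResolutionInsep` datum of one family from a resolution of its radicial generic fibre.**
`A` a Noetherian domain of characteristic `p`, `L` a perfect field radicial over `A` (injective structure
map; every `x` satisfies `b · x ^ (p ^ n) = a`, `b ≠ 0`), `f : 𝒳 → Spec A` proper with `𝒳 ×_A Spec L`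
integral and resolvable ⇒ a radicial finite-type injective `A → A'` and `G : 𝒴 → 𝒳 ×_A Spec A'` all of
whose field-valued fibres are weak resolutions: the spreading theorem with embedding (p532724), the
embedding `A' ↪ L` pulling the radicial relations back. [cite: EGAIV3, Thm. 8.10.5] -/
theorem exists_familyResolutionInsep_datum_of_hasResolution (p : ℕ) [Fact p.Prime] (A : Type) [CommRing A]
    [IsDomain A] [IsNoetherianRing A] [CharP A p] (L : Type) [Field L] [PerfectField L] [Algebra A L]
    (hAL : Function.Injective (algebraMap A L))
    (hrad : ∀ x : L, ∃ (n : ℕ) (a b : A), b ≠ 0 ∧ algebraMap A L b * x ^ p ^ n = algebraMap A L a)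
    (𝒳 : Scheme.{0}) (f : 𝒳 ⟶ Spec (.of A)) [IsProper f]
    (hint : IsIntegral (pullback f (Spec.map (CommRingCat.ofHom (algebraMap A L)))))
    (hY : Scheme.HasResolution (pullback f (Spec.map (CommRingCat.ofHom (algebraMap A L))))) :
    ∃ (A' : Type) (_ : CommRing A') (_ : IsDomain A') (_ : Algebra A A'),
      Function.Injective (algebraMap A A') ∧ Algebra.FiniteType A A' ∧
      (∀ x : A', ∃ (n : ℕ) (a b : A), b ≠ 0 ∧ algebraMap A A' b * x ^ p ^ n = algebraMap A A' a) ∧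
      ∃ (𝒴 : Scheme.{0})
        (G : 𝒴 ⟶ pullback f (Spec.map (CommRingCat.ofHom (algebraMap A A')))),
        ∀ (Ω : Type) [Field Ω] (φ : A' →+* Ω),
          IsWeakResolution
            (pullback.snd G
              (pullback.fst (pullback.snd f (Spec.map (CommRingCat.ofHom (algebraMap A A'))))
                (Spec.map (CommRingCat.ofHom φ)))) := by
  -- `L` is algebraic over `A` (each `x` is a root of `C b * X ^ (p ^ n) - C a ≠ 0`)
  haveI : Algebra.IsAlgebraic A L := by
    refine ⟨fun x => ?_⟩
    obtain ⟨n, a, b, hb, h⟩ := hrad x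
    have hdeg : 0 < p ^ n := pow_pos (Fact.out : p.Prime).pos n
    refine ⟨Polynomial.C b * Polynomial.X ^ (p ^ n) - Polynomial.C a, ?_, by simp [h]⟩
    intro h0
    have h1 := congrArg Polynomial.natDegree h0
    rw [Polynomial.natDegree_sub_eq_left_of_natDegree_lt (by
        rw [Polynomial.natDegree_C, Polynomial.natDegree_C_mul_X_pow _ _ hb]; exact hdeg),
      Polynomial.natDegree_C_mul_X_pow _ _ hb, Polynomial.natDegree_zero] at h1
    exact hdeg.ne' h1
  obtain ⟨A', _, _, _, hinj, hft, -, ⟨e, he⟩, 𝒴, G, hG⟩ :=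
    PrimeModelTransfer.exists_familyResolution_datum_embedding A L hAL 𝒳 f hint hY
  refine ⟨A', inferInstance, inferInstance, inferInstance, hinj, hft, fun x => ?_, 𝒴, G, hG⟩
  obtain ⟨n, a, b, hb, h⟩ := hrad (e x)
  refine ⟨n, a, b, hb, he ?_⟩
  rw [map_mul, map_pow, e.commutes, e.commutes]
  exact h

/-- **RADICIAL FAMILY RESOLUTION FOR FAMILIES OF CURVES, unconditionally**: the datum of
`FamilyResolutionInsep` exists for every proper family over a Noetherian domain of characteristic `p` whose
integral radicial generic fibre has dimension `≤ 1` (resolution of curves over the perfect field `L`, tree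
`hasResolution_of_dim_le_one`, then `exists_familyResolutionInsep_datum_of_hasResolution`).
[cite: Hartshorne1977, Ch. V Rem. 3.8.1] [cite: EGAIV3, Thm. 8.10.5] -/
theorem exists_familyResolutionInsep_datum_of_dim_le_one (p : ℕ) [Fact p.Prime] (A : Type) [CommRing A]
    [IsDomain A] [IsNoetherianRing A] [CharP A p] (L : Type) [Field L] [PerfectField L] [Algebra A L]
    (hAL : Function.Injective (algebraMap A L))
    (hrad : ∀ x : L, ∃ (n : ℕ) (a b : A), b ≠ 0 ∧ algebraMap A L b * x ^ p ^ n = algebraMap A L a)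
    (𝒳 : Scheme.{0}) (f : 𝒳 ⟶ Spec (.of A)) [IsProper f]
    (hint : IsIntegral (pullback f (Spec.map (CommRingCat.ofHom (algebraMap A L)))))
    (hdim : topologicalKrullDim ↥(pullback f (Spec.map (CommRingCat.ofHom (algebraMap A L)))) ≤ 1) :
    ∃ (A' : Type) (_ : CommRing A') (_ : IsDomain A') (_ : Algebra A A'),
      Function.Injective (algebraMap A A') ∧ Algebra.FiniteType A A' ∧
      (∀ x : A', ∃ (n : ℕ) (a b : A), b ≠ 0 ∧ algebraMap A A' b * x ^ p ^ n = algebraMap A A' a) ∧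
      ∃ (𝒴 : Scheme.{0})
        (G : 𝒴 ⟶ pullback f (Spec.map (CommRingCat.ofHom (algebraMap A A')))),
        ∀ (Ω : Type) [Field Ω] (φ : A' →+* Ω),
          IsWeakResolution
            (pullback.snd G
              (pullback.fst (pullback.snd f (Spec.map (CommRingCat.ofHom (algebraMap A A'))))
                (Spec.map (CommRingCat.ofHom φ)))) := by
  haveI := hint
  exact exists_familyResolutionInsep_datum_of_hasResolution p A L hAL hrad 𝒳 f hint
    (hasResolution_of_dim_le_one _
      (pullback.snd f (Spec.map (CommRingCat.ofHom (algebraMap A L)))) hdim)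

/-- **Radicial family resolution in fibre dimension `≤ 3`, modulo F-02** (`CossartPiltant2019` as the
hypothesis `h`; CONDITIONAL result): the datum of `FamilyResolutionInsep` exists for every proper family
over a Noetherian domain of characteristic `p` whose integral radicial generic fibre has dimension `≤ 3`.
[cite: CossartPiltant2019, Thm. 1.1] [cite: EGAIV3, Thm. 8.10.5] -/
theorem exists_familyResolutionInsep_datum_of_dim_le_three (h : CossartPiltant2019.{0}) (p : ℕ) [Fact p.Prime]
    (A : Type) [CommRing A] [IsDomain A] [IsNoetherianRing A] [CharP A p] (L : Type) [Field L]
    [PerfectField L] [Algebra A L] (hAL : Function.Injective (algebraMap A L))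
    (hrad : ∀ x : L, ∃ (n : ℕ) (a b : A), b ≠ 0 ∧ algebraMap A L b * x ^ p ^ n = algebraMap A L a)
    (𝒳 : Scheme.{0}) (f : 𝒳 ⟶ Spec (.of A)) [IsProper f]
    (hint : IsIntegral (pullback f (Spec.map (CommRingCat.ofHom (algebraMap A L)))))
    (hdim : topologicalKrullDim ↥(pullback f (Spec.map (CommRingCat.ofHom (algebraMap A L)))) ≤ 3) :
    ∃ (A' : Type) (_ : CommRing A') (_ : IsDomain A') (_ : Algebra A A'),
      Function.Injective (algebraMap A A') ∧ Algebra.FiniteType A A' ∧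
      (∀ x : A', ∃ (n : ℕ) (a b : A), b ≠ 0 ∧ algebraMap A A' b * x ^ p ^ n = algebraMap A A' a) ∧
      ∃ (𝒴 : Scheme.{0})
        (G : 𝒴 ⟶ pullback f (Spec.map (CommRingCat.ofHom (algebraMap A A')))),
        ∀ (Ω : Type) [Field Ω] (φ : A' →+* Ω),
          IsWeakResolution
            (pullback.snd G
              (pullback.fst (pullback.snd f (Spec.map (CommRingCat.ofHom (algebraMap A A'))))
                (Spec.map (CommRingCat.ofHom φ)))) := by
  haveI := hint
  haveI : CharP L p := charP_of_injective_algebraMap hAL p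
  exact exists_familyResolutionInsep_datum_of_hasResolution p A L hAL hrad 𝒳 f hint
    (hasResolution_of_dim_le_three h (p := p) L _
      (pullback.snd f (Spec.map (CommRingCat.ofHom (algebraMap A L)))) hdim)

end Summit.ResolutionOfSingularities.ResolutionOfSingularities.Theorems.CampaignW82

end
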